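import Literature.MathematicalPhysics.KineticTheory.HardSphereEulerPrimitiveForm
import Literature.Analysis.FunctionSpaces.TorusCalculusProofs
import HarnessLib

/-!
# Route `MourreKoopmanCharges`, crux `LinearToEntropyInBand` (stmt-AtomisticToContinuum-17740), skeleton v8:
# stub 4a-ii, missing lemma M2 — the streaming `v`-part of the local-Gibbs exponent is the kinetic summand of `visCoreN`

Support file (`--supports stmt-AtomisticToContinuum-17740`; registered helper `kineticPart_gExp_eq_visKin_summand`;
worker of lead prover-line-…-17740-c5-0, wave 4; plan `work/stubs/WINDOWCLAUSE-PLAN.md` § 1 (1), § 3 M2).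

For smooth profiles `a, θ > 0`, `u` on `𝕋³` (one frozen time) the one-body local-Gibbs exponent
`g(y, v) = log a(y) − (3/2) log(2π θ(y)) − ‖v − u(y)‖² / (2 θ(y))` is AFFINE in `(1, v, ‖v‖²/2)` with the
entropy-variable coefficients `λ⁰ = log a − (3/2) log(2πθ) − ‖u‖²/(2θ)`, `λʲ = u_j/θ`, `λ⁴ = −θ⁻¹`
(`gExp_eq_affine`), hence its streaming `v`-part `Σ_k v_k ∂_k g(·, v)(x)` is
`⟪∇λ⁰(x), v⟫ + Σ_j ⟪∇λʲ(x), v⟫ v_j + ⟪∇λ⁴(x), v⟫ ‖v‖²/2` — verbatim the summand of the kinetic piece `visKinN` of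
`visCoreN` (DefsB (e) / toolkit A) at the test fields `(A₀, A, A₄) = (∇λ⁰, (∇λʲ)_j, ∇λ⁴)`.  Pure torus calculus
(`Torus.fderiv`, `Torus.gradient`, `Torus.partialDeriv` of `Literature/Analysis/FunctionSpaces/TorusCalculus`):
the Fréchet derivative of the re-centred lift is linear in the function.  Nothing here restates the crux, a stub or
the Statement.  References: H.-T. Yau, Lett. Math. Phys. 22 (1991) § 2; H. Spohn, *Large Scale Dynamics of
Interacting Particles* (1991), Part I § 3.3.
-/

noncomputable section

open MeasureTheory Filter Set
open scoped ENNReal Topology InnerProductSpace BigOperators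

namespace Summit.AtomisticToContinuum.HydrodynamicLimit.Theorems.LTEInBand

open Literature.MathematicalPhysics.KineticTheory Literature.Analysis.FluidPDE Literature.Analysis.FunctionSpaces

/-! ## Smoothness of the entropy-variable coefficients -/

section Smooth

variable {a θ : T3 → ℝ} {u : T3 → V3}

/-- `log a` is smooth for a smooth positive `a`. -/
theorem isSmooth_log (ha : Torus.IsSmooth a) (ha0 : ∀ x, 0 < a x) : Torus.IsSmooth fun y => Real.log (a y) :=
  ContDiff.log ha fun _ => (ha0 _).ne'

/-- `λʲ = u_j / θ` is smooth. -/
theorem isSmooth_vel_div (hθ : Torus.IsSmooth θ) (hu : Torus.IsSmooth u) (hθ0 : ∀ x, 0 < θ x) (j : Fin 3) :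
    Torus.IsSmooth fun y => u y j / θ y :=
  ContDiff.div (hu.apply j) hθ fun _ => (hθ0 _).ne'

/-- `λ⁴ = −θ⁻¹` is smooth. -/
theorem isSmooth_neg_inv (hθ : Torus.IsSmooth θ) (hθ0 : ∀ x, 0 < θ x) : Torus.IsSmooth fun y => -(θ y)⁻¹ :=
  ContDiff.neg (ContDiff.inv hθ fun _ => (hθ0 _).ne')

/-- The exponent `y ↦ g(y, v)` at a frozen velocity `v` is smooth. -/
theorem isSmooth_gExp (ha : Torus.IsSmooth a) (hθ : Torus.IsSmooth θ) (hu : Torus.IsSmooth u)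
    (ha0 : ∀ x, 0 < a x) (hθ0 : ∀ x, 0 < θ x) (v : V3) :
    Torus.IsSmooth fun y => Real.log (a y) - 3 / 2 * Real.log (2 * Real.pi * θ y) - ‖v - u y‖ ^ 2 / (2 * θ y) := by
  have h1 : Torus.IsSmooth fun y => Real.log (2 * Real.pi * θ y) :=
    ContDiff.log (ContDiff.mul contDiff_const hθ) fun _ => (mul_pos Real.two_pi_pos (hθ0 _)).ne'
  have h2 : Torus.IsSmooth fun y => ‖v - u y‖ ^ 2 := ContDiff.norm_sq ℝ (ContDiff.sub contDiff_const hu)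
  exact ContDiff.sub (ContDiff.sub (isSmooth_log ha ha0) (ContDiff.mul contDiff_const h1))
    (ContDiff.div h2 (ContDiff.mul contDiff_const hθ) fun _ => (mul_pos two_pos (hθ0 _)).ne')

/-- `λ⁰ = log a − (3/2) log(2πθ) − ‖u‖²/(2θ)` (the exponent at `v = 0`) is smooth. -/
theorem isSmooth_lam0 (ha : Torus.IsSmooth a) (hθ : Torus.IsSmooth θ) (hu : Torus.IsSmooth u)
    (ha0 : ∀ x, 0 < a x) (hθ0 : ∀ x, 0 < θ x) :
    Torus.IsSmooth fun y => Real.log (a y) - 3 / 2 * Real.log (2 * Real.pi * θ y) - ‖u y‖ ^ 2 / (2 * θ y) := by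
  have h := isSmooth_gExp ha hθ hu ha0 hθ0 0
  simpa only [zero_sub, norm_neg] using h

end Smooth

/-! ## The exponent is affine in `(1, v, ‖v‖²/2)` -/

/-- **The local-Gibbs exponent in entropy variables** (pointwise algebra, `θ(y) ≠ 0`):
`g(y, v) = λ⁰(y) + Σ_j λʲ(y) v_j + λ⁴(y) ‖v‖²/2`. -/
theorem gExp_eq_affine {a θ : T3 → ℝ} {u : T3 → V3} (hθ0 : ∀ x, 0 < θ x) (y : T3) (v : V3) :
    Real.log (a y) - 3 / 2 * Real.log (2 * Real.pi * θ y) - ‖v - u y‖ ^ 2 / (2 * θ y) =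
      (Real.log (a y) - 3 / 2 * Real.log (2 * Real.pi * θ y) - ‖u y‖ ^ 2 / (2 * θ y)) +
        (∑ j : Fin 3, v j * (u y j / θ y)) + ‖v‖ ^ 2 / 2 * (-(θ y)⁻¹) := by
  have hθy : θ y ≠ 0 := (hθ0 y).ne'
  simp only [EuclideanSpace.norm_sq_eq, Fin.sum_univ_three, PiLp.sub_apply, Real.norm_eq_abs, sq_abs]
  field_simp
  ring

/-! ## M2: the streaming `v`-part of the exponent is the kinetic summand of `visCoreN` -/

/-- **(M2) The streaming `v`-part of the local-Gibbs exponent is the kinetic summand of `visCoreN` at the test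
fields `∇λ = (∇λ⁰, (∇(u_j/θ))_j, ∇(−1/θ))`**: for smooth positive profiles at a fixed time,
`Σ_k v_k ∂_k g(·, v)(x) = ⟪∇λ⁰(x), v⟫ + Σ_j ⟪∇λʲ(x), v⟫ v_j + ⟪∇λ⁴(x), v⟫ ‖v‖²/2`,
`λ⁰ = log a − (3/2) log(2πθ) − ‖u‖²/(2θ)` (chain rule: `fderiv_apply_eq_sum_partialDeriv`, `inner_gradient_left`,
linearity of the Fréchet derivative of the re-centred lift). -/
theorem kineticPart_gExp_eq_visKin_summand {a θ : T3 → ℝ} {u : T3 → V3} (ha : Torus.IsSmooth a)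
    (hθ : Torus.IsSmooth θ) (hu : Torus.IsSmooth u) (ha0 : ∀ x, 0 < a x) (hθ0 : ∀ x, 0 < θ x) (x : T3) (v : V3) :
    ∑ k : Fin 3, v k * Torus.partialDeriv k
        (fun y => Real.log (a y) - 3 / 2 * Real.log (2 * Real.pi * θ y) - ‖v - u y‖ ^ 2 / (2 * θ y)) x =
      ⟪Torus.gradient (fun y => Real.log (a y) - 3 / 2 * Real.log (2 * Real.pi * θ y) - ‖u y‖ ^ 2 / (2 * θ y)) x, v⟫_ℝ +
        (∑ j : Fin 3, ⟪Torus.gradient (fun y => u y j / θ y) x, v⟫_ℝ * v j) +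
        ⟪Torus.gradient (fun y => -(θ y)⁻¹) x, v⟫_ℝ * ‖v‖ ^ 2 / 2 := by
  -- the four smooth functions and their `C¹` versions
  set g : T3 → ℝ := fun y => Real.log (a y) - 3 / 2 * Real.log (2 * Real.pi * θ y) - ‖v - u y‖ ^ 2 / (2 * θ y)
    with hg
  set l0 : T3 → ℝ := fun y => Real.log (a y) - 3 / 2 * Real.log (2 * Real.pi * θ y) - ‖u y‖ ^ 2 / (2 * θ y)
    with hl0
  set φ : Fin 3 → T3 → ℝ := fun j y => u y j / θ y with hφ
  set ψ : T3 → ℝ := fun y => -(θ y)⁻¹ with hψ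
  have hg1 : Torus.IsContDiff 1 g := (isSmooth_gExp ha hθ hu ha0 hθ0 v).isContDiff (by simp)
  have hl01 : Torus.IsContDiff 1 l0 := (isSmooth_lam0 ha hθ hu ha0 hθ0).isContDiff (by simp)
  have hφ1 : ∀ j, Torus.IsContDiff 1 (φ j) := fun j => (isSmooth_vel_div hθ hu hθ0 j).isContDiff (by simp)
  have hψ1 : Torus.IsContDiff 1 ψ := (isSmooth_neg_inv hθ hθ0).isContDiff (by simp)
  -- both sides are Fréchet derivatives of re-centred lifts at `0`, applied to `v`
  have hL : ∑ k : Fin 3, v k * Torus.partialDeriv k g x = Torus.fderiv g x v := by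
    rw [Torus.fderiv_apply_eq_sum_partialDeriv hg1]
    simp only [smul_eq_mul]
  rw [hL, Torus.inner_gradient_left, Torus.inner_gradient_left]
  simp_rw [Torus.inner_gradient_left]
  -- the lift of `g` is the affine combination of the lifts of `λ⁰, λʲ, λ⁴`
  have hfun : Torus.liftAt g x = fun w => Torus.liftAt l0 x w + (∑ j : Fin 3, v j * Torus.liftAt (φ j) x w) +
      ‖v‖ ^ 2 / 2 * Torus.liftAt ψ x w := by
    funext w
    simp only [Torus.liftAt_apply, hg, hl0, hφ, hψ]
    exact gExp_eq_affine hθ0 _ v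
  -- derivatives of the lifts at `0`
  have hD : ∀ {f : T3 → ℝ}, Torus.IsContDiff 1 f →
      HasFDerivAt (Torus.liftAt f x) (_root_.fderiv ℝ (Torus.liftAt f x) 0) 0 := fun hf =>
    ((hf.liftAt x).differentiable one_ne_zero).differentiableAt.hasFDerivAt
  have hsum : HasFDerivAt (fun w => Torus.liftAt l0 x w + (∑ j : Fin 3, v j * Torus.liftAt (φ j) x w) +
      ‖v‖ ^ 2 / 2 * Torus.liftAt ψ x w)
      (_root_.fderiv ℝ (Torus.liftAt l0 x) 0 + (∑ j : Fin 3, v j • _root_.fderiv ℝ (Torus.liftAt (φ j) x) 0) +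
        (‖v‖ ^ 2 / 2) • _root_.fderiv ℝ (Torus.liftAt ψ x) 0) 0 :=
    ((hD hl01).fun_add (HasFDerivAt.fun_sum fun j _ => (hD (hφ1 j)).const_mul (v j))).fun_add
      ((hD hψ1).const_mul (‖v‖ ^ 2 / 2))
  have hfd : Torus.fderiv g x = _root_.fderiv ℝ (Torus.liftAt l0 x) 0 +
      (∑ j : Fin 3, v j • _root_.fderiv ℝ (Torus.liftAt (φ j) x) 0) + (‖v‖ ^ 2 / 2) • _root_.fderiv ℝ (Torus.liftAt ψ x) 0 := by
    rw [Torus.fderiv, hfun]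
    exact hsum.fderiv
  rw [hfd]
  simp only [Torus.fderiv, _root_.add_apply, _root_.sum_apply, _root_.smul_apply, smul_eq_mul]
  rw [mul_comm (‖v‖ ^ 2 / 2), mul_div_assoc]
  congr 1
  congr 1
  exact Finset.sum_congr rfl fun j _ => mul_comm _ _

/-! ## The registered helper stub -/

/-- **Registered helper stub `stub_windowClauseExponent` (M2 of the plan of stub 4a-ii, skeleton v8, crux stmt-17740)**:
the streaming `v`-part of the local-Gibbs exponent is the kinetic summand of `visCoreN` at the entropy-variable test
fields — `kineticPart_gExp_eq_visKin_summand` restated with fully qualified names (the registered one-line signature). -/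
theorem stub_windowClauseExponent : ∀ (a θ : Literature.MathematicalPhysics.KineticTheory.T3 → ℝ) (u : Literature.MathematicalPhysics.KineticTheory.T3 → Literature.MathematicalPhysics.KineticTheory.V3), Literature.Analysis.FunctionSpaces.Torus.IsSmooth a → Literature.Analysis.FunctionSpaces.Torus.IsSmooth θ → Literature.Analysis.FunctionSpaces.Torus.IsSmooth u → (∀ x, 0 < a x) → (∀ x, 0 < θ x) → ∀ (x : Literature.MathematicalPhysics.KineticTheory.T3) (v : Literature.MathematicalPhysics.KineticTheory.V3), ∑ k : Fin 3, v k * Literature.Analysis.FunctionSpaces.Torus.partialDeriv k (fun y => Real.log (a y) - 3 / 2 * Real.log (2 * Real.pi * θ y) - ‖v - u y‖ ^ 2 / (2 * θ y)) x = inner ℝ (Literature.Analysis.FunctionSpaces.Torus.gradient (fun y => Real.log (a y) - 3 / 2 * Real.log (2 * Real.pi * θ y) - ‖u y‖ ^ 2 / (2 * θ y)) x) v + (∑ j : Fin 3, inner ℝ (Literature.Analysis.FunctionSpaces.Torus.gradient (fun y => u y j / θ y) x) v * v j) + inner ℝ (Literature.Analysis.FunctionSpaces.Torus.gradient (fun y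 => -(θ y)⁻¹) x) v * ‖v‖ ^ 2 / 2 :=
  fun _ _ _ ha hθ hu ha0 hθ0 x v => kineticPart_gExp_eq_visKin_summand ha hθ hu ha0 hθ0 x v

end Summit.AtomisticToContinuum.HydrodynamicLimit.Theorems.LTEInBand

end
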